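import Summits.CriticalPhenomena.PercolationContinuityZ3.Theorems.SahiMasterFamilyZeroFlagMinorPsi
import Summits.CriticalPhenomena.PercolationContinuityZ3.Theorems.SahiMasterFamilyPointwiseCoordinateGluingSandwichApex

/-!
# The 0-minor side, core case: `Λ = F(A,B;G) + (nonnegative)` — MD_3 on the D0 core reduces to ONE new 3-set inequality `F ≥ 0`

Unit `prim-master-conj` (crux anchor stmt-CriticalPhenomena-4575, helper work), gen 20; memo
`run/shared/lean/prim/prim-l12/prim-master-conj/POINTWISE.md` §21.  Companion of gen 19's `…ZeroFlagMinorPsi`.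

SETTING (the "D0 core", memo §20.4): an increasing triple `U` and a coordinate `e` such that the `0`-minor
`P = U^{e←0} = (X, Y, G)` is a zero flag with trivial forced hull (`X ⊆ G`, `Y ⊆ G`, `X ⟂ Y` i.e. `μ(X∩Y) = μX·μY`) and the third member
does not depend on `e` (`U_2^{e←1} = U_2^{e←0} = G`); `Q = U^{e←1} = (A, B, G) ⊇ P`.  By gen 19 (`…ExplicitMinorDominationSingle`) `MD_3` at `(U,e)`
is the single inequality `Λ := mixC2(P,Q) − E_3(Q) ≥ 0`.

THE NEW INEQUALITY (gen 20, memo §21.2; CONJECTURE with strong exact evidence, NOT proved here): for increasing events `A, B, G` and a product measure,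
  `F(A,B;G) := (1 + μG)·μ(A∩B∩G) − μG·μ(A∩B) − μ(A∩G)·μ(B∩G) ≥ 0`,
equivalently `Cov(A∩G, B∩G) ≥ μ(G)·μ(A∩B∖G)`, equivalently `μ(ABG) ≥ μ(AG)μ(BG) + μ(G)μ(AB∖G)` ("conditioning on an increasing event `G` can make
increasing events negatively correlated, but by at most `[μ(AB|G) − μ(AB)]/μ(G)`").  Tight for `A ⟂ B ⊆ G` (zero flags), for `A = B = Ω`, and at the classical
example `A = x₁, B = x₂, G = x₁ ∨ x₂`.  Evidence: ALL multi-affine Bernstein coefficients of `F` are `≥ 0` for every triple of up-sets of `{0,1}^k`,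
`k ≤ 4` (exhaustive, 4,741,632 triples at `k = 4`), plus exact random tests to `n = 6`; `F` is NOT a constant-coefficient combination of Harris
covariances over the free distributive lattice on `A, B, G` (LP), and the `X = ∅` case of the D0 core is equivalent to it.

THIS FILE (identities + a conditional reduction; axioms standard):
* `mixC2_sub_sahiE_eq_F_add` — for ANY weight, any `P, Q` with `Q 2 = P 2` and the four `κ = 1` sandwich relations on `P`
  (`m(P₀P₁) = p₀p₁`, `m(P₀P₂) = p₀`, `m(P₁P₂) = p₁`, `m(P₀P₁P₂) = p₀p₁`):
  **`Λ = F(Q₀,Q₁;P₂) + (1 − p₂)·[m(Q₀Q₁P₂) + p₀p₁ − p₀q₁ − p₁q₀] + (m(Q₀P₂) − p₀)·(m(Q₁P₂) − p₁)`**.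
* `mixC2_sub_sahiE_ge_F` — on the core the middle bracket is `μ((A∖X)∩(B∖Y)∩G) + Cov(X,B) + Cov(A,Y) ≥ 0` and the last product is
  `μ(A∩G∖X)·μ(B∩G∖Y) ≥ 0`; hence **`Λ ≥ F(A,B;G)`** on the D0 core.
* `sahiE_three_ge_sq_minor_of_F_nonneg` — **MD_3 at `(U,e)` on the D0 core follows from `F(A,B;G) ≥ 0`** (`A, B` the `1`-sections of `U_0, U_1`,
  `G` the `e`-free third member): `(1−p_e)²E_3(U⁰) + p_e²E_3(U¹) ≤ E_3(U)`.
* `sahiE_three_ge_sq_minor_of_union_subset` — the unconditional sub-case `A ∪ B ⊆ G` (there `F = Cov(A,B) ≥ 0`, Harris).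
HONEST FRAMING: identities, a conditional reduction and one Harris-level corollary; `F ≥ 0` in general and `C_3` remain OPEN. [this work]
-/

noncomputable section

open scoped Classical

namespace Summit.CriticalPhenomena.PercolationContinuityZ3.Theorems

open Finset Function
open Literature.Combinatorics.Sahi2008
open Literature.Probability.Percolation.DecisionTree (ind)
open SahiCombMix

namespace Pointwise

variable {ι : Type} [Fintype ι]

/-! ### 1. The identity `Λ = F + (1−g)·[…] + (…)(…)` under the `κ = 1` sandwich relations and `Q 2 = P 2` -/

section Identity

variable (μ : Set ι → ℝ) (P Q : Fin 3 → Set (Set ι)) (hG : Q 2 = P 2)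
  (h1 : ex μ (ind (P 0) * ind (P 1)) = ex μ (ind (P 0)) * ex μ (ind (P 1)))
  (h2 : ex μ (ind (P 0) * ind (P 2)) = ex μ (ind (P 0)))
  (h3 : ex μ (ind (P 1) * ind (P 2)) = ex μ (ind (P 1)))
  (h4 : ex μ (ind (P 0) * ind (P 1) * ind (P 2)) = ex μ (ind (P 0)) * ex μ (ind (P 1)))
include hG h1 h2 h3 h4

/-- **`Λ = F(A,B;G) + (1−g)·[m(ABG) + xy − x·b − y·a] + (m(AG) − x)(m(BG) − y)`** on the D0 core (file header; `x = μP₀`, `y = μP₁`,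
`g = μP₂`, `a = μQ₀`, `b = μQ₁`, `G = P₂ = Q₂`). Pure algebra from the four `κ = 1` sandwich relations. [this work] -/
theorem mixC2_sub_sahiE_eq_F_add :
    mixC2 μ P Q - sahiE μ 3 (fun j => ind (Q j))
      = ((1 + ex μ (ind (P 2))) * ex μ (ind (Q 0) * ind (Q 1) * ind (P 2))
            - ex μ (ind (P 2)) * ex μ (ind (Q 0) * ind (Q 1))
            - ex μ (ind (Q 0) * ind (P 2)) * ex μ (ind (Q 1) * ind (P 2)))
        + (1 - ex μ (ind (P 2))) * (ex μ (ind (Q 0) * ind (Q 1) * ind (P 2)) + ex μ (ind (P 0)) * ex μ (ind (P 1))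
            - ex μ (ind (P 0)) * ex μ (ind (Q 1)) - ex μ (ind (P 1)) * ex μ (ind (Q 0)))
        + (ex μ (ind (Q 0) * ind (P 2)) - ex μ (ind (P 0))) * (ex μ (ind (Q 1) * ind (P 2)) - ex μ (ind (P 1))) := by
  rw [mixC2, sahiE_three_apply]
  simp only [hG]
  linear_combination (-(ex μ (ind (P 2)))) * h1 - ex μ (ind (Q 1)) * h2 - ex μ (ind (Q 0)) * h3 + 2 * h4

end Identity

/-! ### 2. The core reduction for an increasing triple -/

section Core

variable (p : ι → unitInterval) (e : ι) (U : Fin 3 → Set (Set ι)) (hU : ∀ j, IsUpperSet (U j))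
  (hG : secAt e true (U 2) = secAt e false (U 2))
  (hXG : secAt e false (U 0) ⊆ secAt e false (U 2)) (hYG : secAt e false (U 1) ⊆ secAt e false (U 2))
  (hXY : ex (bernoulliWeight p) (ind (secAt e false (U 0) ∩ secAt e false (U 1)))
    = ex (bernoulliWeight p) (ind (secAt e false (U 0))) * ex (bernoulliWeight p) (ind (secAt e false (U 1))))
include hU hG hXG hYG hXY

/-- **`Λ ≥ F(A,B;G)` on the D0 core.**  For an increasing triple `U` whose third member is `e`-free (`hG`) and whose `0`-minor `(X,Y,G)` has
`X, Y ⊆ G` and `X ⟂ Y` at `μ_p` (`hXY`): with `A = U_0^{e←1}`, `B = U_1^{e←1}`, `G = U_2^{e←0}`,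
`mixC2(U⁰,U¹) − E_3(U¹) ≥ (1+μG)μ(ABG) − μG·μ(AB) − μ(AG)μ(BG)`; the difference is
`(1−μG)·[μ((A∖X)(B∖Y)G) + Cov(X,B) + Cov(A,Y)] + μ(AG∖X)·μ(BG∖Y) ≥ 0` (Harris twice and cells). [this work] -/
theorem mixC2_sub_sahiE_ge_F :
    (1 + ex (bernoulliWeight p) (ind (secAt e false (U 2))))
          * ex (bernoulliWeight p) (ind (secAt e true (U 0) ∩ secAt e true (U 1) ∩ secAt e false (U 2)))
        - ex (bernoulliWeight p) (ind (secAt e false (U 2))) * ex (bernoulliWeight p) (ind (secAt e true (U 0) ∩ secAt e true (U 1)))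
        - ex (bernoulliWeight p) (ind (secAt e true (U 0) ∩ secAt e false (U 2)))
          * ex (bernoulliWeight p) (ind (secAt e true (U 1) ∩ secAt e false (U 2)))
      ≤ mixC2 (bernoulliWeight p) (fun j => secAt e false (U j)) (fun j => secAt e true (U j))
          - sahiE (bernoulliWeight p) 3 (fun j => ind (secAt e true (U j))) := by
  set m := bernoulliWeight p with hm
  set X := secAt e false (U 0); set Y := secAt e false (U 1); set G := secAt e false (U 2)
  set A := secAt e true (U 0); set B := secAt e true (U 1)
  have hXu : IsUpperSet X := isUpperSet_secAt e false (hU 0)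
  have hYu : IsUpperSet Y := isUpperSet_secAt e false (hU 1)
  have hGu : IsUpperSet G := isUpperSet_secAt e false (hU 2)
  have hAu : IsUpperSet A := isUpperSet_secAt e true (hU 0)
  have hBu : IsUpperSet B := isUpperSet_secAt e true (hU 1)
  have sA : X ⊆ A := RigidityAll.secAt_false_subset_secAt_true e (hU 0)
  have sB : Y ⊆ B := RigidityAll.secAt_false_subset_secAt_true e (hU 1)
  -- the four `κ = 1` sandwich relations in product form
  have eXG : X ∩ G = X := Set.inter_eq_left.mpr hXG
  have eYG : Y ∩ G = Y := Set.inter_eq_left.mpr hYG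
  have eXYG : X ∩ Y ∩ G = X ∩ Y := Set.inter_eq_left.mpr (fun ω hω => hXG hω.1)
  have h1 : ex m (ind X * ind Y) = ex m (ind X) * ex m (ind Y) := by rw [ind_mul_ind_eq_inter]; exact hXY
  have h2 : ex m (ind X * ind G) = ex m (ind X) := by rw [ind_mul_ind_eq_inter, eXG]
  have h3 : ex m (ind Y * ind G) = ex m (ind Y) := by rw [ind_mul_ind_eq_inter, eYG]
  have h4 : ex m (ind X * ind Y * ind G) = ex m (ind X) * ex m (ind Y) := by
    rw [ind_mul_ind_eq_inter, ind_mul_ind_eq_inter, eXYG]; exact hXY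
  have hId := mixC2_sub_sahiE_eq_F_add m (fun j => secAt e false (U j)) (fun j => secAt e true (U j)) hG h1 h2 h3 h4
  simp only [ind_mul_ind_eq_inter] at hId
  -- positivity of the two extra terms
  have tg : 0 ≤ 1 - ex m (ind G) := by rw [one_sub_ex_ind p G]; exact ex_ind_nonneg' p _
  have tcell : 0 ≤ ex m (ind (G ∩ A ∩ B)) - ex m (ind (G ∩ A ∩ Y)) - ex m (ind (G ∩ X ∩ B)) + ex m (ind (G ∩ X ∩ Y)) := by
    rw [← cell_inter_sdiff_sdiff m G sA sB]; exact ex_ind_nonneg' p _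
  have tXB : 0 ≤ ex m (ind (X ∩ B)) - ex m (ind X) * ex m (ind B) := cov_ind_nonneg p hXu hBu
  have tAY : 0 ≤ ex m (ind (A ∩ Y)) - ex m (ind A) * ex m (ind Y) := cov_ind_nonneg p hAu hYu
  have sAG : X ⊆ A ∩ G := fun ω hω => Set.mem_inter (sA hω) (hXG hω)
  have sBG : Y ⊆ B ∩ G := fun ω hω => Set.mem_inter (sB hω) (hYG hω)
  have tAG : 0 ≤ ex m (ind (A ∩ G)) - ex m (ind X) := by
    rw [ex_ind_sub_of_subset _ sAG]; exact ex_ind_nonneg' p _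
  have tBG : 0 ≤ ex m (ind (B ∩ G)) - ex m (ind Y) := by
    rw [ex_ind_sub_of_subset _ sBG]; exact ex_ind_nonneg' p _
  have tprod := mul_nonneg tAG tBG
  -- set bookkeeping
  have e1 : G ∩ A ∩ B = A ∩ B ∩ G := by ac_rfl
  have e2 : G ∩ A ∩ Y = A ∩ Y := by
    rw [show G ∩ A ∩ Y = A ∩ (Y ∩ G) by ac_rfl, eYG]
  have e3 : G ∩ X ∩ B = X ∩ B := by
    rw [show G ∩ X ∩ B = (X ∩ G) ∩ B by ac_rfl, eXG]
  have e4 : G ∩ X ∩ Y = X ∩ Y := by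
    rw [show G ∩ X ∩ Y = X ∩ Y ∩ G by ac_rfl, eXYG]
  rw [e1, e2, e3, e4] at tcell
  have hXY' : ex m (ind (X ∩ Y)) = ex m (ind X) * ex m (ind Y) := hXY
  have tbr : 0 ≤ ex m (ind (A ∩ B ∩ G)) + ex m (ind X) * ex m (ind Y)
      - ex m (ind X) * ex m (ind B) - ex m (ind Y) * ex m (ind A) := by nlinarith [tcell, tXB, tAY, hXY']
  have t2 := mul_nonneg tg tbr
  rw [hId]
  nlinarith [t2, tprod]

/-- **MD_3 on the D0 core from `F(A,B;G) ≥ 0`.**  Under the hypotheses of `mixC2_sub_sahiE_ge_F`, if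
`0 ≤ (1+μG)μ(ABG) − μG·μ(AB) − μ(AG)μ(BG)` (`A = U_0^{e←1}`, `B = U_1^{e←1}`, `G = U_2^{e←0} = U_2^{e←1}`) then
`(1−p_e)²·E_3(μ_p;U^{e←0}) + p_e²·E_3(μ_p;U^{e←1}) ≤ E_3(μ_p;U)` (the first summand is `0` here). [this work] -/
theorem sahiE_three_ge_sq_minor_of_F_nonneg
    (hF : 0 ≤ (1 + ex (bernoulliWeight p) (ind (secAt e false (U 2))))
          * ex (bernoulliWeight p) (ind (secAt e true (U 0) ∩ secAt e true (U 1) ∩ secAt e false (U 2)))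
        - ex (bernoulliWeight p) (ind (secAt e false (U 2))) * ex (bernoulliWeight p) (ind (secAt e true (U 0) ∩ secAt e true (U 1)))
        - ex (bernoulliWeight p) (ind (secAt e true (U 0) ∩ secAt e false (U 2)))
          * ex (bernoulliWeight p) (ind (secAt e true (U 1) ∩ secAt e false (U 2)))) :
    (1 - (p e : ℝ)) ^ 2 * sahiE (bernoulliWeight p) 3 (fun j => ind (secAt e false (U j)))
      + (p e : ℝ) ^ 2 * sahiE (bernoulliWeight p) 3 (fun j => ind (secAt e true (U j)))
      ≤ sahiE (bernoulliWeight p) 3 (fun j => ind (U j)) := by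
  refine sahiE_three_ge_sq_minors_of_mixC2_ge e U hU p ?_
  have h := mixC2_sub_sahiE_ge_F p e U hU hG hXG hYG hXY
  linarith

/-- **Unconditional sub-case `A ∪ B ⊆ G`.**  If moreover both `1`-sections lie inside the (`e`-free) third member then
`F(A,B;G) = Cov(A,B) ≥ 0` (Harris), so `MD_3` holds at `(U,e)`. [this work] -/
theorem sahiE_three_ge_sq_minor_of_union_subset
    (hAG : secAt e true (U 0) ⊆ secAt e false (U 2)) (hBG : secAt e true (U 1) ⊆ secAt e false (U 2)) :
    (1 - (p e : ℝ)) ^ 2 * sahiE (bernoulliWeight p) 3 (fun j => ind (secAt e false (U j)))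
      + (p e : ℝ) ^ 2 * sahiE (bernoulliWeight p) 3 (fun j => ind (secAt e true (U j)))
      ≤ sahiE (bernoulliWeight p) 3 (fun j => ind (U j)) := by
  refine sahiE_three_ge_sq_minor_of_F_nonneg p e U hU hG hXG hYG hXY ?_
  set m := bernoulliWeight p with hm
  set G := secAt e false (U 2); set A := secAt e true (U 0); set B := secAt e true (U 1)
  have hAu : IsUpperSet A := isUpperSet_secAt e true (hU 0)
  have hBu : IsUpperSet B := isUpperSet_secAt e true (hU 1)
  have eABG : A ∩ B ∩ G = A ∩ B := Set.inter_eq_left.mpr (fun ω hω => hAG hω.1)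
  have eAG : A ∩ G = A := Set.inter_eq_left.mpr hAG
  have eBG : B ∩ G = B := Set.inter_eq_left.mpr hBG
  rw [eABG, eAG, eBG]
  have tAB : 0 ≤ ex m (ind (A ∩ B)) - ex m (ind A) * ex m (ind B) := cov_ind_nonneg p hAu hBu
  nlinarith [tAB]

end Core

/-! ### 3. Two more unconditional sub-cases (gen 20 append): comparable `1`-sections -/

section Comparable

variable (p : ι → unitInterval) (e : ι) (U : Fin 3 → Set (Set ι)) (hU : ∀ j, IsUpperSet (U j))
  (hG : secAt e true (U 2) = secAt e false (U 2))
  (hXG : secAt e false (U 0) ⊆ secAt e false (U 2)) (hYG : secAt e false (U 1) ⊆ secAt e false (U 2))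
  (hXY : ex (bernoulliWeight p) (ind (secAt e false (U 0) ∩ secAt e false (U 1)))
    = ex (bernoulliWeight p) (ind (secAt e false (U 0))) * ex (bernoulliWeight p) (ind (secAt e false (U 1))))
include hU hG hXG hYG hXY

/-- **Unconditional sub-case `G ⊆ A`** (the `e`-free third member lies inside the `1`-section of the first): there
`F(A,B;G) = μ(B∩G) − μG·μ(A∩B) ≥ μ(B∩G) − μG·μB ≥ 0` (Harris), so `MD_3` holds at `(U,e)`. [this work] -/
theorem sahiE_three_ge_sq_minor_of_third_subset_first (hGA : secAt e false (U 2) ⊆ secAt e true (U 0)) :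
    (1 - (p e : ℝ)) ^ 2 * sahiE (bernoulliWeight p) 3 (fun j => ind (secAt e false (U j)))
      + (p e : ℝ) ^ 2 * sahiE (bernoulliWeight p) 3 (fun j => ind (secAt e true (U j)))
      ≤ sahiE (bernoulliWeight p) 3 (fun j => ind (U j)) := by
  refine sahiE_three_ge_sq_minor_of_F_nonneg p e U hU hG hXG hYG hXY ?_
  set m := bernoulliWeight p with hm
  set G := secAt e false (U 2); set A := secAt e true (U 0); set B := secAt e true (U 1)
  have hAu : IsUpperSet A := isUpperSet_secAt e true (hU 0)
  have hBu : IsUpperSet B := isUpperSet_secAt e true (hU 1)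
  have hGu : IsUpperSet G := isUpperSet_secAt e false (hU 2)
  have eABG : A ∩ B ∩ G = B ∩ G := by
    ext ω; constructor
    · rintro ⟨⟨_, hB⟩, hG'⟩; exact ⟨hB, hG'⟩
    · rintro ⟨hB, hG'⟩; exact ⟨⟨hGA hG', hB⟩, hG'⟩
  have eAG : A ∩ G = G := Set.inter_eq_right.mpr hGA
  rw [eABG, eAG]
  have tBG : 0 ≤ ex m (ind (B ∩ G)) - ex m (ind B) * ex m (ind G) := cov_ind_nonneg p hBu hGu
  have tAB : 0 ≤ ex m (ind B) - ex m (ind (A ∩ B)) := by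
    rw [ex_ind_sub_of_subset _ (Set.inter_subset_right : A ∩ B ⊆ B)]; exact ex_ind_nonneg' p _
  have tg : 0 ≤ ex m (ind G) := ex_ind_nonneg' p _
  nlinarith [tBG, tAB, tg, mul_nonneg tg tAB]

/-- **Unconditional sub-case `A ⊆ B`** (nested `1`-sections): there `F(A,B;G) = μ(A∩G)·(1 + μG − μ(B∩G)) − μG·μA ≥ 0`
(`μ(B∩G) ≤ μG` and Harris `μ(A∩G) ≥ μA·μG`), so `MD_3` holds at `(U,e)`. [this work] -/
theorem sahiE_three_ge_sq_minor_of_first_subset_second (hAB : secAt e true (U 0) ⊆ secAt e true (U 1)) :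
    (1 - (p e : ℝ)) ^ 2 * sahiE (bernoulliWeight p) 3 (fun j => ind (secAt e false (U j)))
      + (p e : ℝ) ^ 2 * sahiE (bernoulliWeight p) 3 (fun j => ind (secAt e true (U j)))
      ≤ sahiE (bernoulliWeight p) 3 (fun j => ind (U j)) := by
  refine sahiE_three_ge_sq_minor_of_F_nonneg p e U hU hG hXG hYG hXY ?_
  set m := bernoulliWeight p with hm
  set G := secAt e false (U 2); set A := secAt e true (U 0); set B := secAt e true (U 1)
  have hAu : IsUpperSet A := isUpperSet_secAt e true (hU 0)
  have hGu : IsUpperSet G := isUpperSet_secAt e false (hU 2)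
  have eABG : A ∩ B ∩ G = A ∩ G := by rw [Set.inter_eq_left.mpr hAB]
  have eAB : A ∩ B = A := Set.inter_eq_left.mpr hAB
  rw [eABG, eAB]
  have tAG : 0 ≤ ex m (ind (A ∩ G)) - ex m (ind A) * ex m (ind G) := cov_ind_nonneg p hAu hGu
  have tBG : 0 ≤ ex m (ind G) - ex m (ind (B ∩ G)) := by
    rw [ex_ind_sub_of_subset _ (Set.inter_subset_right : B ∩ G ⊆ G)]; exact ex_ind_nonneg' p _
  have tAGn : 0 ≤ ex m (ind (A ∩ G)) := ex_ind_nonneg' p _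
  nlinarith [tAG, tBG, tAGn, mul_nonneg tAGn tBG]

end Comparable

end Pointwise

end Summit.CriticalPhenomena.PercolationContinuityZ3.Theorems

end
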